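/-
Copyright (c) 2026 the pub-hodgecm-mathlib formalisation cell (harness21).  Prover seat hodgecm-mathlib-K2Liu-p03 (g5): Track B «K2-LIT»,
#184♮ = hLiu418 = stmt-HodgeConjecture-24832; Road Φ of socket #41 `sig_K2LiuSiegelEisensteinContinuation`, organ Φ3a (LEAD F0P6-plan (g11)
ruling «M-155l» (3c) «Φ3 → K2Liu-p03, census-first»; census `K2/K2Liu-p03/g5/CENSUS-PHI3-PureTensorEuler.K2Liu-p03-g5.md` 1ba823c269d9da75 §1 row Φ3a).
-/
import Summits.HodgeConjecture.HodgeConjecture.Theorems.K2LiuIwasawaDatumStdSmooth   -- ★ J1(b): `exists_isOpen_forall_mul_eq_of_isStd` (+ ★ `IwasawaDatum.IsStd`, `UnitaryGroupAdelicProduct`)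
import Literature.NumberTheory.Automorphic.UnitaryGroupRestrictedProduct             -- ★ `finAdelicEquiv`, `evalPlace`, `isOpen_localInt`
import HarnessLib

/-!
# Crux `HLiu418`, Road Φ of socket #41, organ Φ3a: A STANDARD IWASAWA DATUM HAS A LEVEL OFF A FINITE SET OF PLACES

Cell `hodgecm-mathlib`, crux item hLiu418 = `stmt-HodgeConjecture-24832`, route of record `HCCMUnconditional`; squad K2 ∕ K2Liu.
THEOREMS ONLY (no `def`, no instance, no notation, no named-fact hypothesis, no `sorry`); lane `--supports stmt-HodgeConjecture-24832`.

WHY.  The «pure tensor» half of Road Φ's organ Φ3 («`IsStd` ⇒ the standard family factorises, `W_β` is an Euler product») is ★ #31s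
`K2LiuStdFamilyFactorisable.stdFamilyFactorisable`: a standard family `f` (★ `IsStandardSectionFamily 𝒦 χ f`) that is right-invariant at ONE
parameter under the level
`K^S_H = {k ∈ H(𝔸) : k_∞ = 1, k_v ∈ K_{H,v} = H(𝒪_v) for all v, k_v = 1 for v ∈ S}`
with `K^S_H ⊆ 𝒦.K` factorises off `S`: `f_s(h) = f_s(placesEmbed(h_∞, h_S)) · ∏ᶠ_{v∉S} Λ_{s,v}(h_v)`.  #31s takes the two facts «`K^S_H ⊆ 𝒦.K`» (`_hK`)
and «`f_{s₀}` is right-`K^S_H`-invariant» (`_hR`) BY VALUE.  This file DISCHARGES both for every STANDARD datum (★ `IwasawaDatum.IsStd`, LEAD ruling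
«M-155j»: `𝒦.K = C_∞ · C_f` with `C_f` OPEN in `H(𝔸_f)`) and every continuous standard family — so #41's binders `(_h𝒦 : 𝒦.IsStd)`,
`IsStandardSectionFamily 𝒦 χ f`, `∀ s, Continuous (f s)` are exactly what Φ3 needs, nothing more.

THE STATEMENTS (namespace `…Cruxes.HLiu418.K2LiuStdDatumLevelOffS`; `S₀ ⊆ S` monotone in `S`, so one `S₀` serves every larger `S`).
* `exists_finset_box_subset` — THE RESTRICTED-PRODUCT NEIGHBOURHOOD BASIS, read on `H(𝔸_f)`: an open `U ∋ 1` of `H(𝔸_f)` (★ `UnitaryGroup.finAdelic`)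
  contains, for some finite `S₀` and all `S ⊇ S₀`, every `k` with `k_v ∈ K_{H,v}` for all `v` and `k_v = 1` for `v ∈ S` — transport of Mathlib's
  `RestrictedProduct.nhds_eq_map_structureMap` (the box `∏_v K_{H,v}` is an open subspace carrying the PRODUCT topology) and `nhds_pi` ∕ `Filter.mem_pi'`
  through ★ `finAdelicEquiv : H(𝔸_f) ≃ₜ* ∏'_v [H(L⁺_v), K_{H,v}]` (whose `v`-coordinate is ★ `evalPlace v`, `rfl`).
* `exists_finset_KS_le_of_isStd` — (i) `𝒦.IsStd → ∃ S₀, ∀ S ⊇ S₀, K^S_H ⊆ 𝒦.K` (#31s's `_hK` binder verbatim), from ★ `IsStd.exists_fin` (`C_f` open,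
  `(1, C_f) ⊆ 𝒦.K`) and ★ `archToAdelic_mul_finAdelicToAdelic` (`k = (1, k_f)` when `k_∞ = 1`).
* `exists_finset_forall_mul_eq_of_isStd` — (ii) for `φ` `𝒦.K`-finite and continuous: `∃ S₀, ∀ S ⊇ S₀, ∀ h, ∀ k ∈ K^S_H, φ(h k) = φ(h)` (#31s's `_hR` shape),
  from ★ J1(b) `exists_isOpen_forall_mul_eq_of_isStd` (an OPEN `U ≤ H(𝔸_f)` acting trivially).
* `exists_finset_level_of_isStandardSectionFamily` — (iii) for a standard family with `∀ s, Continuous (f s)` and a parameter `s₀`: ONE `S₀` such that for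
  all `S ⊇ S₀` both `K^S_H ⊆ 𝒦.K` and `f_{s₀}(h k) = f_{s₀}(h)` (`k ∈ K^S_H`) — the two by-value hypotheses of ★ #31s, ready to be fed together with ★
  `K2LiuLocalSiegelIwasawa` (local Iwasawa at good places) and `χ` unramified off `S`.
[cite: BorelJacquet1979, §4.1 (`G(𝔸_f) = ∏'_v G(F_v)`, `K`-finite vectors are fixed by an open compact subgroup)] [cite: Tan1999, §1 p. 166 (`K = K_∞ ∏_v K_v`, standard sections)]
[cite: PlatonovRapinchuk1994, §5.1 (restricted topological product, basis of neighbourhoods of `1`)] [cite: HarrisKudlaSweet1996, §1 (1.15)–(1.17)]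

HONEST LABEL: HC_CM is proved only modulo the 7 printed citations (2 remaining named inputs: hLiu418 = stmt-HodgeConjecture-24832,
h413 = stmt-HodgeConjecture-24833) until rung 0 closes; this file is a helper (`--supports stmt-HodgeConjecture-24832`) and closes no socket by itself.

## References
* [BorelJacquet1979] A. Borel, H. Jacquet, *Automorphic forms and automorphic representations*, PSPM 33.1 (1979), §4.1.
* [PlatonovRapinchuk1994] V. Platonov, A. Rapinchuk, *Algebraic Groups and Number Theory*, Academic Press (1994), §5.1.
* [Tan1999] V. Tan, *Poles of Siegel Eisenstein series on U(n,n)*, Canad. J. Math. 51 (1999), §1 p. 166.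
* [HarrisKudlaSweet1996] M. Harris, S. Kudla, W. J. Sweet, J. AMS 9 (1996), §1 (1.15)–(1.17).
-/

set_option autoImplicit false
-- the mandated namespace repeats the single-problem summit's segment (`HodgeConjecture.HodgeConjecture`)
set_option linter.dupNamespace false

noncomputable section

open scoped RestrictedProduct Topology
open NumberField IsDedekindDomain Filter Set

namespace Summit.HodgeConjecture.HodgeConjecture.Cruxes.HLiu418.K2LiuStdDatumLevelOffS

open Literature.NumberTheory.Automorphic Literature.NumberTheory.GaloisRepresentations
open Literature.NumberTheory.GelbartRogawski1991 Literature.NumberTheory.GelbartRogawski1991.GRConstruction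
open Literature.NumberTheory.K2Lit.SiegelDoubled
open Summit.HodgeConjecture.HodgeConjecture.Cruxes.HLiu418.K2LiuIwasawaDatumStdSmooth (exists_isOpen_forall_mul_eq_of_isStd)

/-! ## §1 The restricted-product neighbourhood basis of `H(𝔸_f)`, read through `evalPlace` -/

section Generic

variable (F E : Type) [Field F] [NumberField F] [Field E] [NumberField E] [Algebra F E]
  (c : E ≃ₐ[F] E) (N : ℕ) (J : Matrix (Fin N) (Fin N) E)

/-- **An open neighbourhood of `1` in `H(𝔸_f)` contains the level `K^S_H` for every large finite `S`.**  If `U ⊆ U(J)(𝔸_{F,f})` is open and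
`1 ∈ U`, there is a finite set `S₀` of finite places such that for every finite `S ⊇ S₀`, every `k` with `k_v ∈ U(J)(𝒪_v)` for all `v` and `k_v = 1`
for `v ∈ S` lies in `U` (`k_v` = ★ `evalPlace v k`).  The restricted topological product has the boxes `∏_{v∈S} V_v × ∏_{v∉S} U(J)(𝒪_v)` as a basis
of neighbourhoods of `1`. [cite: PlatonovRapinchuk1994, §5.1] [cite: BorelJacquet1979, §4.1] -/
theorem exists_finset_box_subset {U : Set (UnitaryGroup.finAdelic F E c N J)} (hU : IsOpen U)
    (h1 : (1 : UnitaryGroup.finAdelic F E c N J) ∈ U) :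
    ∃ S₀ : Finset (HeightOneSpectrum (𝓞 F)), ∀ S : Finset (HeightOneSpectrum (𝓞 F)), S₀ ⊆ S →
      ∀ k : UnitaryGroup.finAdelic F E c N J,
        (∀ v, UnitaryGroup.evalPlace F E c N J v k ∈ UnitaryGroup.localInt E c N J v) →
        (∀ v ∈ S, UnitaryGroup.evalPlace F E c N J v k = 1) → k ∈ U := by
  classical
  -- transport `U` to the restricted product `∏'_v [U(J)(F_v), U(J)(𝒪_v)]` along ★ `finAdelicEquiv`
  have hU' : IsOpen ((UnitaryGroup.finAdelicEquiv F E c N J).symm ⁻¹' U) :=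
    hU.preimage (UnitaryGroup.finAdelicEquiv F E c N J).symm.continuous
  have h1' : (1 : Πʳ v : HeightOneSpectrum (𝓞 F), [UnitaryGroup.localPi E c N J v, UnitaryGroup.localInt E c N J v]) ∈
      (UnitaryGroup.finAdelicEquiv F E c N J).symm ⁻¹' U := by
    rw [mem_preimage, map_one]
    exact h1
  -- the base point `1` of the box `∏_v U(J)(𝒪_v)` (product topology) and its image `structureMap 1 = 1`
  have hAopen : ∀ v : HeightOneSpectrum (𝓞 F),
      IsOpen ((fun v => (UnitaryGroup.localInt E c N J v : Set (UnitaryGroup.localPi E c N J v))) v) :=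
    fun v => UnitaryGroup.isOpen_localInt E c N J v
  obtain ⟨x₁, hx₁⟩ : ∃ x₁ : Π v : HeightOneSpectrum (𝓞 F), ↥((fun v => (UnitaryGroup.localInt E c N J v : Set (UnitaryGroup.localPi E c N J v))) v),
      ∀ v, (x₁ v : UnitaryGroup.localPi E c N J v) = 1 :=
    ⟨fun v => ⟨1, (UnitaryGroup.localInt E c N J v).one_mem⟩, fun _ => rfl⟩
  have hsm : RestrictedProduct.structureMap (fun v => UnitaryGroup.localPi E c N J v)
      (fun v => (UnitaryGroup.localInt E c N J v : Set (UnitaryGroup.localPi E c N J v))) cofinite x₁ = 1 :=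
    RestrictedProduct.ext _ _ fun v => by rw [RestrictedProduct.structureMap_apply, hx₁, RestrictedProduct.one_apply]
  -- the neighbourhood filter of `1` in the restricted product is the image of that of the box (Mathlib)
  have hnhds : (UnitaryGroup.finAdelicEquiv F E c N J).symm ⁻¹' U ∈
      Filter.map (RestrictedProduct.structureMap (fun v => UnitaryGroup.localPi E c N J v)
        (fun v => (UnitaryGroup.localInt E c N J v : Set (UnitaryGroup.localPi E c N J v))) cofinite) (𝓝 x₁) := by
    rw [← RestrictedProduct.nhds_eq_map_structureMap hAopen x₁, hsm]
    exact hU'.mem_nhds h1'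
  rw [Filter.mem_map, nhds_pi, Filter.mem_pi'] at hnhds
  obtain ⟨I, t, ht, hIt⟩ := hnhds
  refine ⟨I, fun S hS k hkK hkS => ?_⟩
  -- the point of the box with the coordinates of `k`
  obtain ⟨x, hx⟩ : ∃ x : Π v : HeightOneSpectrum (𝓞 F), ↥((fun v => (UnitaryGroup.localInt E c N J v : Set (UnitaryGroup.localPi E c N J v))) v),
      ∀ v, (x v : UnitaryGroup.localPi E c N J v) = UnitaryGroup.evalPlace F E c N J v k :=
    ⟨fun v => ⟨UnitaryGroup.evalPlace F E c N J v k, hkK v⟩, fun _ => rfl⟩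
  have hxk : RestrictedProduct.structureMap (fun v => UnitaryGroup.localPi E c N J v)
      (fun v => (UnitaryGroup.localInt E c N J v : Set (UnitaryGroup.localPi E c N J v))) cofinite x =
        UnitaryGroup.finAdelicEquiv F E c N J k :=
    RestrictedProduct.ext _ _ fun v => by rw [RestrictedProduct.structureMap_apply, hx]; rfl
  -- `x` lies in the basic box `∏_{v∈I} t_v`: its coordinates on `I ⊆ S` are `1 = x₁ v ∈ t_v`
  have hxI : x ∈ (↑I : Set (HeightOneSpectrum (𝓞 F))).pi t := by
    intro v hv
    have hv' : v ∈ S := hS (Finset.mem_coe.1 hv)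
    have hxv : x v = x₁ v := Subtype.ext (by rw [hx, hx₁, hkS v hv'])
    rw [hxv]
    exact mem_of_mem_nhds (ht v)
  have hmem := hIt hxI
  rw [mem_preimage, hxk, mem_preimage, ContinuousMulEquiv.symm_apply_apply] at hmem
  exact hmem

end Generic

/-! ## §2 Standard data: the level `K^S_H ⊆ 𝒦.K` and the invariance of `𝒦.K`-finite continuous functions -/

variable (L : Type) [Field L] [NumberField L] [IsCMField L]
variable {N M n : ℕ} (e : Fin N × Fin M ≃ Fin n)
  (dV : Fin N → L) (hdV : ∀ i, IsCMField.complexConj L (dV i) = dV i)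
  (dW : Fin M → L) (hdW : ∀ i, IsCMField.complexConj L (dW i) = dW i)

/-- **(i) A STANDARD datum contains the level `K^S_H` for every large `S`** (#31s's `_hK` binder verbatim): if `𝒦.IsStd` then for some finite `S₀`
and all finite `S ⊇ S₀`, every `k ∈ H(𝔸)` with `k_∞ = 1`, `k_v ∈ K_{H,v}` for all `v` and `k_v = 1` for `v ∈ S` lies in `𝒦.K`.  Proof: `𝒦.K ⊇ (1, C_f)`
with `C_f` open in `H(𝔸_f)` (★ `IsStd.exists_fin`), `k = (1, k_f)` (★ `archToAdelic_mul_finAdelicToAdelic`), and §1.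
[cite: Tan1999, §1 p. 166] [cite: BorelJacquet1979, §4.1] -/
theorem exists_finset_KS_le_of_isStd {𝒦 : IwasawaDatum L e dV hdV dW hdW} (h𝒦 : 𝒦.IsStd) :
    ∃ S₀ : Finset (HeightOneSpectrum (𝓞 (Fp L))), ∀ S : Finset (HeightOneSpectrum (𝓞 (Fp L))), S₀ ⊆ S →
      ∀ k : HA L e dV hdV dW hdW,
        UnitaryGroup.archPart (Fp L) L (IsCMField.complexConj L) (n + n) (hermD L e dV hdV dW hdW) k = 1 →
        (∀ v, UnitaryGroup.evalPlace (Fp L) L (IsCMField.complexConj L) (n + n) (hermD L e dV hdV dW hdW) v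
            (UnitaryGroup.finPart (Fp L) L (IsCMField.complexConj L) (n + n) (hermD L e dV hdV dW hdW) k) ∈
          UnitaryGroup.localInt L (IsCMField.complexConj L) (n + n) (hermD L e dV hdV dW hdW) v) →
        (∀ v ∈ S, UnitaryGroup.evalPlace (Fp L) L (IsCMField.complexConj L) (n + n) (hermD L e dV hdV dW hdW) v
            (UnitaryGroup.finPart (Fp L) L (IsCMField.complexConj L) (n + n) (hermD L e dV hdV dW hdW) k) = 1) →
        k ∈ 𝒦.K := by
  obtain ⟨Cfin, hCo, hCK, -⟩ := h𝒦.exists_fin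
  obtain ⟨S₀, hS₀⟩ := exists_finset_box_subset (Fp L) L (IsCMField.complexConj L) (n + n) (hermD L e dV hdV dW hdW) hCo Cfin.one_mem
  refine ⟨S₀, fun S hS k hk1 hkK hkS => ?_⟩
  have hkf : UnitaryGroup.finPart (Fp L) L (IsCMField.complexConj L) (n + n) (hermD L e dV hdV dW hdW) k ∈ Cfin :=
    hS₀ S hS _ hkK hkS
  have hk : k = UnitaryGroup.finAdelicToAdelic (Fp L) L (IsCMField.complexConj L) (n + n) (hermD L e dV hdV dW hdW)
      (UnitaryGroup.finPart (Fp L) L (IsCMField.complexConj L) (n + n) (hermD L e dV hdV dW hdW) k) := by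
    have h := UnitaryGroup.archToAdelic_mul_finAdelicToAdelic (Fp L) L (IsCMField.complexConj L) (n + n) (hermD L e dV hdV dW hdW) k
    rw [hk1, map_one, one_mul] at h
    exact h.symm
  rw [hk]
  exact hCK _ hkf

/-- **(ii) A `𝒦.K`-finite continuous function on `H(𝔸)` is right-invariant under `K^S_H` for every large `S`** (#31s's `_hR` shape), for a
STANDARD datum `𝒦`: ★ J1(b) `exists_isOpen_forall_mul_eq_of_isStd` gives an OPEN `U ≤ H(𝔸_f)` acting trivially, and §1 puts `K^S_H` inside `(1, U)`.
[cite: BorelJacquet1979, §4.1] [cite: HarrisKudlaSweet1996, §1 (1.16)] -/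
theorem exists_finset_forall_mul_eq_of_isStd {𝒦 : IwasawaDatum L e dV hdV dW hdW} (h𝒦 : 𝒦.IsStd)
    {φ : HA L e dV hdV dW hdW → ℂ} (hφ : IsKFinite 𝒦 φ) (hφc : Continuous φ) :
    ∃ S₀ : Finset (HeightOneSpectrum (𝓞 (Fp L))), ∀ S : Finset (HeightOneSpectrum (𝓞 (Fp L))), S₀ ⊆ S →
      ∀ h k : HA L e dV hdV dW hdW,
        UnitaryGroup.archPart (Fp L) L (IsCMField.complexConj L) (n + n) (hermD L e dV hdV dW hdW) k = 1 →
        (∀ v, UnitaryGroup.evalPlace (Fp L) L (IsCMField.complexConj L) (n + n) (hermD L e dV hdV dW hdW) v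
            (UnitaryGroup.finPart (Fp L) L (IsCMField.complexConj L) (n + n) (hermD L e dV hdV dW hdW) k) ∈
          UnitaryGroup.localInt L (IsCMField.complexConj L) (n + n) (hermD L e dV hdV dW hdW) v) →
        (∀ v ∈ S, UnitaryGroup.evalPlace (Fp L) L (IsCMField.complexConj L) (n + n) (hermD L e dV hdV dW hdW) v
            (UnitaryGroup.finPart (Fp L) L (IsCMField.complexConj L) (n + n) (hermD L e dV hdV dW hdW) k) = 1) →
        φ (h * k) = φ h := by
  obtain ⟨U, hUo, hU⟩ := exists_isOpen_forall_mul_eq_of_isStd h𝒦 hφ hφc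
  obtain ⟨S₀, hS₀⟩ := exists_finset_box_subset (Fp L) L (IsCMField.complexConj L) (n + n) (hermD L e dV hdV dW hdW) hUo U.one_mem
  exact ⟨S₀, fun S hS h k hk1 hkK hkS => hU k hk1 (hS₀ S hS _ hkK hkS) h⟩

/-- **(iii) THE TWO BY-VALUE HYPOTHESES OF ★ #31s FOR A STANDARD FAMILY OVER A STANDARD DATUM.**  For `𝒦.IsStd`, a standard family `f`
(★ `IsStandardSectionFamily 𝒦 χ f`) with every `f_s` continuous, and a parameter `s₀`: there is a finite `S₀` such that for every finite `S ⊇ S₀`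
(a) `K^S_H ⊆ 𝒦.K` and (b) `f_{s₀}(h k) = f_{s₀}(h)` for all `h` and all `k ∈ K^S_H` — so ★ `stdFamilyFactorisable` applies off any such `S` that also
contains the ramification of `χ` and the bad places of the local Iwasawa decomposition: `f_s(h) = f_s(placesEmbed(h_∞,h_S)) · ∏ᶠ_{v∉S} Λ_{s,v}(h_v)`.
[cite: Tan1999, §1 p. 166] [cite: BorelJacquet1979, §4.1] [cite: HarrisKudlaSweet1996, §1 (1.15)–(1.17)] -/
theorem exists_finset_level_of_isStandardSectionFamily {𝒦 : IwasawaDatum L e dV hdV dW hdW} (h𝒦 : 𝒦.IsStd)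
    {χ : HeckeCharacter L} {f : ℂ → HA L e dV hdV dW hdW → ℂ} (hf : IsStandardSectionFamily 𝒦 χ f)
    (hcont : ∀ s, Continuous (f s)) (s₀ : ℂ) :
    ∃ S₀ : Finset (HeightOneSpectrum (𝓞 (Fp L))), ∀ S : Finset (HeightOneSpectrum (𝓞 (Fp L))), S₀ ⊆ S →
      (∀ k : HA L e dV hdV dW hdW,
        UnitaryGroup.archPart (Fp L) L (IsCMField.complexConj L) (n + n) (hermD L e dV hdV dW hdW) k = 1 →
        (∀ v, UnitaryGroup.evalPlace (Fp L) L (IsCMField.complexConj L) (n + n) (hermD L e dV hdV dW hdW) v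
            (UnitaryGroup.finPart (Fp L) L (IsCMField.complexConj L) (n + n) (hermD L e dV hdV dW hdW) k) ∈
          UnitaryGroup.localInt L (IsCMField.complexConj L) (n + n) (hermD L e dV hdV dW hdW) v) →
        (∀ v ∈ S, UnitaryGroup.evalPlace (Fp L) L (IsCMField.complexConj L) (n + n) (hermD L e dV hdV dW hdW) v
            (UnitaryGroup.finPart (Fp L) L (IsCMField.complexConj L) (n + n) (hermD L e dV hdV dW hdW) k) = 1) →
        k ∈ 𝒦.K) ∧
      ∀ h k : HA L e dV hdV dW hdW,
        UnitaryGroup.archPart (Fp L) L (IsCMField.complexConj L) (n + n) (hermD L e dV hdV dW hdW) k = 1 →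
        (∀ v, UnitaryGroup.evalPlace (Fp L) L (IsCMField.complexConj L) (n + n) (hermD L e dV hdV dW hdW) v
            (UnitaryGroup.finPart (Fp L) L (IsCMField.complexConj L) (n + n) (hermD L e dV hdV dW hdW) k) ∈
          UnitaryGroup.localInt L (IsCMField.complexConj L) (n + n) (hermD L e dV hdV dW hdW) v) →
        (∀ v ∈ S, UnitaryGroup.evalPlace (Fp L) L (IsCMField.complexConj L) (n + n) (hermD L e dV hdV dW hdW) v
            (UnitaryGroup.finPart (Fp L) L (IsCMField.complexConj L) (n + n) (hermD L e dV hdV dW hdW) k) = 1) →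
        f s₀ (h * k) = f s₀ h := by
  classical
  obtain ⟨S₁, hS₁⟩ := exists_finset_KS_le_of_isStd L e dV hdV dW hdW h𝒦
  obtain ⟨S₂, hS₂⟩ := exists_finset_forall_mul_eq_of_isStd L e dV hdV dW hdW h𝒦 (hf.2.1 s₀) (hcont s₀)
  refine ⟨S₁ ∪ S₂, fun S hS => ⟨?_, ?_⟩⟩
  · exact hS₁ S ((Finset.subset_union_left).trans hS)
  · exact hS₂ S ((Finset.subset_union_right).trans hS)

end Summit.HodgeConjecture.HodgeConjecture.Cruxes.HLiu418.K2LiuStdDatumLevelOffS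

end
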